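import Summits.HodgeConjecture.HodgeConjecture.Theses.PadicSemiregularLift
import Summits.HodgeConjecture.HodgeConjecture.Theorems.PadicSemiregularLiftHodgeAbelianVarietiesStubVhcFromCMFibre
import Summits.HodgeConjecture.HodgeConjecture.Theorems.PadicSemiregularLiftHodgeAbelianVarietiesStubCmAnchoredFamilies
import Summits.HodgeConjecture.HodgeConjecture.Theorems.HodgeAbelianVarieties.Negative.ExtremeCodimensions
import Literature.AlgebraicGeometry.HodgeTheory.LefschetzOneOneHolds
import Literature.AlgebraicGeometry.HodgeTheory.TopDegreeClasses

/-!
# Crux `HodgeAbelianVarieties` (stmt-HodgeConjecture-1333), line `cm-pivot` — stub `stub_localVHCAtCM` (`LocalVHCAtCM[]`): the unconditional corners and the deep-middle localisation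

The registered stub `stub_localVHCAtCM : LocalVHCAtCM[]` (child 3 of the CM pivot, skeleton
`Cruxes/HodgeAbelianVarieties/Lines/cm_pivot.lean`) is Grothendieck's LOCAL variational Hodge
statement at a CM fibre: for a smooth projective family `f : 𝒳 ⟶ S` of relative dimension `m`
(`𝒳`, `S` quasi-projective over `ℂ`, `S` smooth irreducible), a global class
`G ∈ H²ᵖ(𝒳(ℂ); ℂ)` rational `(p,p)` on every fibre presented as an abelian variety, and a CM abelian
variety `A₀ ≅ 𝒳_{s₀}` with `G|_{A₀}` algebraic, there is a Euclidean-open `U ∋ s₀` in `S(ℂ)` with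
`G|_{𝒳_t}` algebraic for all `t ∈ U`. It is HC-implied and — modulo the two other children and two
printed theorems — EQUIVALENT to the Hodge conjecture for the non-CM abelian fibres
(`Stubs.vhcFromCMProj_iff_openNearCM`, file `…StubVhcFromCMFibre`); it is NOT proved here.

What this file PROVES (axioms `propext`/`Classical.choice`/`Quot.sound`), in the pattern of
`Theorems/PadicSemiregularLiftHodgeAbelianVarietiesUnconditionalCorners`
(`hodgeAbelianVarieties_iff_deepMiddle_holds`) and of `Stubs.vhcFromCM_conclusion_zero /
vhcFromCM_conclusion_of_dim_lt`:

* `conclusion_of_extreme` — the conclusion of `LocalVHCAtCM[]` holds OUTRIGHT at every complex point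
  `t` (so with `U = S(ℂ)`, `localVHCAtCM_instance_of_extreme`) when `p = 0` or `m ≤ p`: each fibre
  `𝒳_t` is smooth projective of dimension `m` (`IsSmoothProjectiveFamily.isSmoothProjective`), and
  `N⁰ H⁰ = H⁰` (`hodgeConjectureFor_codim_zero`), `H²ᵐ = Nᵐ H²ᵐ` (`mem_algebraicClasses_of_degree_top`),
  `H²ᵖ = 0` for `p > m` (`ComplexPoints.subsingleton_singularCohomology_of_lt`). No rationality, Hodge
  type, CM anchor or abelian presentation is used.
* `conclusion_of_not_deepMiddle` — at a fibre PRESENTED BY AN ABELIAN VARIETY `B ≅ 𝒳_t` (where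
  `HodgeAlong` supplies rationality and type `(p,p)` of `G|_B`), the conclusion also holds for `p = 1`
  (Lefschetz `(1,1)`, the tree's THEOREM `lefschetzOneOne_rational_holds`) and for `p + 1 = m` (hard
  Lefschetz `L^{m-2} : H² ≅ H^{2m-2}`, the tree's THEOREM
  `HardLefschetzNFold.mem_algebraicClasses_of_lt_holds`, reducing to Lefschetz `(1,1)`); hence for
  every `p` when `m ≤ 3` (`conclusion_of_dim_le_three`).
* `localVHCAtCM_iff_deepMiddle` / `localVHCAtCM_of_deepMiddle` — **the deep-middle localisation**:
  granted that every complex fibre of such a family is presented by an abelian variety (the gallery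
  file's printed hypothesis `AbelianFibres[]`, GIT Thm. 6.14, taken here as an explicit HYPOTHESIS with
  `IsQuasiProjectiveOver` inlined as `QProj[`, never asserted), `LocalVHCAtCM[]` is EQUIVALENT to its
  restriction `LocalVHCAtCMDeepMiddle[]` to `4 ≤ m`, `2 ≤ p`, `p + 2 ≤ m`: the open content of child 3
  lives on abelian fibres of dimension `≥ 4` in codimensions `2 ≤ p ≤ m - 2` (in print `≥ 6`:
  Moonen–Zarhin + Markman settle `dim ≤ 5`, not in the tree).
* `localVHCAtCMDeepMiddle_of_hodge_deepMiddle` — upper bound: the deep-middle germ follows from the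
  deep-middle part of HC for abelian varieties of dimension `≥ 4` (given `AbelianFibres[]`), so it
  claims no more than the crux (`Unconditional.hodgeAbelianVarieties_iff_four_le_dim_holds`).
* Junk audit of the typing (confirming the gallery file's): `localVHCAtCM_hypotheses_nonempty` — the
  nine hypotheses of `LocalVHCAtCM[]` are jointly satisfiable (constant family of the zero abelian
  variety over `Spec ℂ`, `p = 0`, `G = 0`), so the stub is not vacuous; `localVHCAtCM_anchor` — the
  anchor point `s₀` always satisfies the conclusion (so only the NEIGHBOURING fibres carry content, and
  `U = {s₀}` would close the stub exactly when `s₀` is isolated in `S(ℂ)`, i.e. never for `dim S ≥ 1`: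
  `Stubs.interior_setOf_pt_mem_eq_empty`).

Nothing here uses the CM hypothesis `IsCM[A₀]`: the corners are insensitive to the anchor. The
binders `QProj[𝒳]`, `QProj[S]`, `Smooth S.hom`, `IrreducibleSpace S.left` are only threaded through.
-/

set_option linter.dupNamespace false

noncomputable section

open CategoryTheory
open Literature.AlgebraicGeometry Literature.AlgebraicGeometry.Motives

namespace Summit.HodgeConjecture.HodgeConjecture.Cruxes.HodgeAbelianVarieties.CMPivot.Stubs

/-! ### The shared statements (copied byte-identically from the registered skeleton `Lines/cm_pivot.lean`) -/

/-- `IsCM[A]` — CM type: an endomorphism with `2 · dim A` distinct eigenvalues on `H¹(A(ℂ); ℂ)`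
(verbatim the gallery line's notation). Local notation only. -/
local notation3 (prettyPrint := false) "IsCM[" A "]" =>
  ∃ (ψ : A ⟶ A) (μ : Fin (2 * AbelianVariety.dim A) → ℂ), Function.Injective μ ∧
    ∀ i, Module.End.HasEigenvalue (HodgeTheory.complexBetti.map ψ.hom.hom.hom 1).hom (μ i)

/-- `QProj[X]` — `X` is quasi-projective over `ℂ`: INLINED body of
`HodgeTheory.IsQuasiProjectiveOver X` (the route file does not import its home module). Local notation only. -/
local notation3 (prettyPrint := false) "QProj[" X "]" =>
  ∃ (P : SchemeOver ℂ) (j : X ⟶ P), IsProjectiveOver P ∧ AlgebraicGeometry.IsOpenImmersion j.left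

/-- `FibreIncl[f, B, e, s]` — `e` presents `B` as THE fibre of `f` over `s` (`≫` spelled out). Local notation only. -/
local notation3 (prettyPrint := false) "FibreIncl[" f ", " B ", " e ", " s "]" =>
  ∃ i : AbelianVariety.X B ≅ fiberOver f s, e = CategoryStruct.comp i.hom (fiberι f s)

/-- `HodgeAlong[S, 𝒳, f, G, p]` — `G` is rational `(p,p)` on every fibre presented as an abelian variety. Local notation only. -/
local notation3 (prettyPrint := false) "HodgeAlong[" S ", " 𝒳 ", " f ", " G ", " p "]" =>
  ∀ (B : AbelianVariety ℂ) (eB : AbelianVariety.X B ⟶ 𝒳) (u : ComplexPoints S),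
    FibreIncl[f, B, eB, u] →
      HodgeTheory.IsRationalClass (HodgeTheory.complexBetti.map eB (2 * p) G) ∧
      HodgeTheory.IsOfHodgeType B.dim B.X (2 * p) p p (HodgeTheory.complexBetti.map eB (2 * p) G)

/-- CHILD 3 `LocalVHCAtCM[]` — local variational Hodge at a CM fibre (= the gallery line's germ
`OpenNearCM[]`, worker file p92924, with `IsQuasiProjectiveOver` inlined). Local notation only. -/
local notation3 (prettyPrint := false) "LocalVHCAtCM[]" =>
  ∀ (S 𝒳 : SchemeOver ℂ) (f : 𝒳 ⟶ S) (m p : ℕ) (G : HodgeTheory.complexBetti 𝒳 (2 * p))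
    (s₀ : ComplexPoints S) (A₀ : AbelianVariety ℂ) (e₀ : A₀.X ⟶ 𝒳),
    QProj[𝒳] → QProj[S] → AlgebraicGeometry.Smooth S.hom → IrreducibleSpace S.left →
    IsSmoothProjectiveFamily f m →
    FibreIncl[f, A₀, e₀, s₀] → IsCM[A₀] →
    HodgeTheory.complexBetti.map e₀ (2 * p) G ∈ HodgeTheory.algebraicClasses A₀.X p →
    HodgeAlong[S, 𝒳, f, G, p] →
    ∃ U : Set (ComplexPoints S), IsOpen U ∧ s₀ ∈ U ∧ ∀ t ∈ U,
      HodgeTheory.complexBetti.map (fiberι f t) (2 * p) G ∈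
        HodgeTheory.algebraicClasses (fiberOver f t) p

/-! ### New local statements: the deep-middle restriction and the abelian-fibres hypothesis -/

/-- `LocalVHCAtCMDeepMiddle[]` — **the DEEP-MIDDLE part of child 3**: `LocalVHCAtCM[]` restricted to
relative dimension `m ≥ 4` and codimensions `2 ≤ p ≤ m - 2` (three extra arrows `4 ≤ m → 2 ≤ p →
p + 2 ≤ m →` after the binders, everything else byte-identical). OPEN (HC-implied); this is where the
content of the stub lives (`localVHCAtCM_iff_deepMiddle`). Local notation only. -/
local notation3 (prettyPrint := false) "LocalVHCAtCMDeepMiddle[]" =>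
  ∀ (S 𝒳 : SchemeOver ℂ) (f : 𝒳 ⟶ S) (m p : ℕ) (G : HodgeTheory.complexBetti 𝒳 (2 * p))
    (s₀ : ComplexPoints S) (A₀ : AbelianVariety ℂ) (e₀ : A₀.X ⟶ 𝒳),
    4 ≤ m → 2 ≤ p → p + 2 ≤ m →
    QProj[𝒳] → QProj[S] → AlgebraicGeometry.Smooth S.hom → IrreducibleSpace S.left →
    IsSmoothProjectiveFamily f m →
    FibreIncl[f, A₀, e₀, s₀] → IsCM[A₀] →
    HodgeTheory.complexBetti.map e₀ (2 * p) G ∈ HodgeTheory.algebraicClasses A₀.X p →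
    HodgeAlong[S, 𝒳, f, G, p] →
    ∃ U : Set (ComplexPoints S), IsOpen U ∧ s₀ ∈ U ∧ ∀ t ∈ U,
      HodgeTheory.complexBetti.map (fiberι f t) (2 * p) G ∈
        HodgeTheory.algebraicClasses (fiberOver f t) p

/-- `AbelianFibres[]` — **every complex fibre of a CM-anchored family as in `LocalVHCAtCM[]` is
presented by an abelian variety** (HYPOTHESIS, never asserted; in print GIT Thm. 6.14: a smooth
projective morphism with a section and one abelian fibre is an abelian scheme — here after the base
change `𝒳 ×_S 𝒳 ⟶ 𝒳` that acquires the diagonal section). This is the gallery file's `AbelianFibres[]`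
(`…StubVhcFromCMFibre`) with `IsQuasiProjectiveOver` inlined as `QProj[` — definitionally the same
statement — and verbatim the inlined hypothesis of the skeleton's `localVHCAtCM_of_hodgeAbelianVarieties`.
Local notation only. [cite: MumfordFogartyKirwan1994, Ch. 6 §1 Thm. 6.14] -/
local notation3 (prettyPrint := false) "AbelianFibres[]" =>
  ∀ (S 𝒳 : SchemeOver ℂ) (f : 𝒳 ⟶ S) (m : ℕ) (s₀ : ComplexPoints S) (A₀ : AbelianVariety ℂ)
    (e₀ : A₀.X ⟶ 𝒳), QProj[𝒳] → QProj[S] → AlgebraicGeometry.Smooth S.hom → IrreducibleSpace S.left →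
    IsSmoothProjectiveFamily f m → FibreIncl[f, A₀, e₀, s₀] →
    ∀ t : ComplexPoints S, ∃ (B : AbelianVariety ℂ) (eB : B.X ⟶ 𝒳), FibreIncl[f, B, eB, t]

/-! ### The corners at ONE fibre -/

section Corners

variable {S 𝒳 : SchemeOver ℂ} {f : 𝒳 ⟶ S} {m : ℕ}

/-- **Extreme codimensions, at every complex point, with no hypothesis on `G`**: for a smooth
projective family of relative dimension `m` and `p = 0` or `m ≤ p`, the restriction of ANY global class
`G ∈ H²ᵖ(𝒳(ℂ); ℂ)` to the fibre `𝒳_t` is algebraic — `𝒳_t` is smooth projective of dimension `m`, and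
`N⁰ H⁰ = H⁰` (`p = 0`), every top-degree class is algebraic (`p = m ≥ 1`,
`mem_algebraicClasses_of_degree_top`), `H²ᵖ(𝒳_t(ℂ); ℂ) = 0` for `p > m` (Hatcher Thm. 3.26(c) on the
closed `2m`-manifold `𝒳_t(ℂ)`). [cite: VoisinHodgeII2003, §10.2.3 proof of Prop. 10.26]
[cite: HatcherAT2002, §3.3 Thm. 3.26(c)] -/
theorem conclusion_of_extreme (hf : IsSmoothProjectiveFamily f m) {p : ℕ} (hp : p = 0 ∨ m ≤ p)
    (G : HodgeTheory.complexBetti 𝒳 (2 * p)) (t : ComplexPoints S) :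
    HodgeTheory.complexBetti.map (fiberι f t) (2 * p) G ∈
      HodgeTheory.algebraicClasses (fiberOver f t) p := by
  have hX : IsSmoothProjective m (fiberOver f t) := hf.isSmoothProjective t
  rcases Nat.eq_zero_or_pos p with rfl | hp0
  · exact HodgeTheory.hodgeConjectureFor_codim_zero _
  have hmp : m ≤ p := hp.resolve_left (by omega)
  rcases hmp.eq_or_lt with rfl | hlt
  · exact HodgeTheory.mem_algebraicClasses_of_degree_top hX hp0 _
  · haveI := ComplexPoints.subsingleton_singularCohomology_of_lt hX ℂ (k := 2 * p) (by omega)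
    rw [Subsingleton.elim (HodgeTheory.complexBetti.map (fiberι f t) (2 * p) G) 0]
    exact Submodule.zero_mem _

/-- **Transfer at a presented fibre**: if `B ≅ 𝒳_t` presents the fibre over `t` as an abelian variety,
`G` is rational `(p,p)` along the abelian fibres, and the rational `(p,p)`-classes of `H²ᵖ(B(ℂ); ℂ)`
are algebraic (a HYPOTHESIS `hB_HC` — the codimension-`p` Hodge conjecture for this one `B`), then
`G|_{𝒳_t}` is algebraic (`HodgeAlong` at `B`, then iso-invariance
`Stubs.map_mem_algebraicClasses_iff_of_fibreIncl`). [folklore] -/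
theorem conclusion_of_fibreIncl (hf : IsSmoothProjectiveFamily f m) {p : ℕ}
    {G : HodgeTheory.complexBetti 𝒳 (2 * p)} {B : AbelianVariety ℂ} {eB : B.X ⟶ 𝒳}
    {t : ComplexPoints S} (hB : FibreIncl[f, B, eB, t]) (hHodge : HodgeAlong[S, 𝒳, f, G, p])
    (hB_HC : ∀ c : HodgeTheory.complexBetti B.X (2 * p), HodgeTheory.IsRationalClass c →
      HodgeTheory.IsOfHodgeType B.dim B.X (2 * p) p p c → c ∈ HodgeTheory.algebraicClasses B.X p) :
    HodgeTheory.complexBetti.map (fiberι f t) (2 * p) G ∈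
      HodgeTheory.algebraicClasses (fiberOver f t) p :=
  (SubtorusGalleryBlochSeeds.Stubs.map_mem_algebraicClasses_iff_of_fibreIncl hf hB p G).1
    (hB_HC _ (hHodge B eB t hB).1 (hHodge B eB t hB).2)

/-- **Codimension `1` at an abelian-presented fibre: Lefschetz `(1,1)`** (the tree's THEOREM
`lefschetzOneOne_rational_holds` on the smooth projective variety `B.X`).
[cite: VoisinHodgeI2002, Thm. 11.30, Cor. 11.34 and §11.3.3] -/
theorem conclusion_of_codim_one (hf : IsSmoothProjectiveFamily f m)
    {G : HodgeTheory.complexBetti 𝒳 (2 * 1)} {B : AbelianVariety ℂ} {eB : B.X ⟶ 𝒳}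
    {t : ComplexPoints S} (hB : FibreIncl[f, B, eB, t]) (hHodge : HodgeAlong[S, 𝒳, f, G, 1]) :
    HodgeTheory.complexBetti.map (fiberι f t) (2 * 1) G ∈
      HodgeTheory.algebraicClasses (fiberOver f t) 1 :=
  conclusion_of_fibreIncl hf hB hHodge fun c hc h11 =>
    HodgeTheory.lefschetzOneOne_rational_holds (AbelianVariety.isSmoothProjective_holds (A := B)) c hc h11

/-- **Codimension `m - 1` at an abelian-presented fibre: hard Lefschetz + Lefschetz `(1,1)`**: for
`p + 1 = m` (so `dim B = m`), if `m ≥ 3` then `m < 2p` and `L^{2p-m} = L^{m-2} : H²(B) ≅ H^{2m-2}(B)`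
reduces the rational `(p,p)`-classes to rational `(1,1)`-classes (the tree's THEOREM
`HardLefschetzNFold.mem_algebraicClasses_of_lt_holds`, fed with `lefschetzOneOne_rational_holds`);
if `m ≤ 2` then `p ≤ 1` (codimension `0` or Lefschetz `(1,1)`).
[cite: VoisinHodgeI2002, Thm. 6.25, Rem. 6.27 and Thm. 11.30] [cite: KerrPearlstein2011, §3.1] -/
theorem conclusion_of_codim_add_one_eq (hf : IsSmoothProjectiveFamily f m) {p : ℕ} (hpm : p + 1 = m)
    {G : HodgeTheory.complexBetti 𝒳 (2 * p)} {B : AbelianVariety ℂ} {eB : B.X ⟶ 𝒳}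
    {t : ComplexPoints S} (hB : FibreIncl[f, B, eB, t]) (hHodge : HodgeAlong[S, 𝒳, f, G, p]) :
    HodgeTheory.complexBetti.map (fiberι f t) (2 * p) G ∈
      HodgeTheory.algebraicClasses (fiberOver f t) p := by
  refine conclusion_of_fibreIncl hf hB hHodge fun c hc hpp => ?_
  have hX : IsSmoothProjective B.dim B.X := AbelianVariety.isSmoothProjective_holds
  have hdim : B.dim = m := SubtorusGalleryBlochSeeds.Stubs.dim_eq_of_fibreIncl hf hB
  -- Lefschetz `(1,1)` on `B.X`, in every spelling `q = 1` of the codimension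
  have h11 : ∀ q : ℕ, q = 1 → ∀ c' : HodgeTheory.complexBetti B.X (2 * q),
      HodgeTheory.IsRationalClass c' → HodgeTheory.IsOfHodgeType B.dim B.X (2 * q) q q c' →
        c' ∈ HodgeTheory.algebraicClasses B.X q := by
    rintro q rfl c' hc' hpp'
    exact HodgeTheory.lefschetzOneOne_rational_holds hX c' hc' hpp'
  rcases Nat.lt_or_ge p 2 with hp2 | hp2
  · -- `p ≤ 1`
    rcases Nat.eq_zero_or_pos p with rfl | hp0
    · exact HodgeTheory.hodgeConjectureFor_codim_zero c
    · exact h11 p (by omega) c hc hpp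
  · -- `m ≥ 3`: hard Lefschetz from codimension `dim B - p = 1`
    exact HodgeTheory.HardLefschetzNFold.mem_algebraicClasses_of_lt_holds hX (by omega)
      (h11 (B.dim - p) (by omega)) c hc hpp

/-- **All corners at an abelian-presented fibre**: outside the deep middle — `p ≤ 1` or `m ≤ p + 1` —
the conclusion of the stub holds at `t` (extreme codimensions: `conclusion_of_extreme`; `p = 1`:
Lefschetz `(1,1)`; `p + 1 = m`: hard Lefschetz). [cite: VoisinHodgeI2002, Thm. 6.25 and Thm. 11.30]
[cite: VoisinHodgeII2003, §10.2.3 proof of Prop. 10.26] -/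
theorem conclusion_of_not_deepMiddle (hf : IsSmoothProjectiveFamily f m) {p : ℕ}
    (hp : p ≤ 1 ∨ m ≤ p + 1) {G : HodgeTheory.complexBetti 𝒳 (2 * p)} {B : AbelianVariety ℂ}
    {eB : B.X ⟶ 𝒳} {t : ComplexPoints S} (hB : FibreIncl[f, B, eB, t])
    (hHodge : HodgeAlong[S, 𝒳, f, G, p]) :
    HodgeTheory.complexBetti.map (fiberι f t) (2 * p) G ∈
      HodgeTheory.algebraicClasses (fiberOver f t) p := by
  by_cases hext : p = 0 ∨ m ≤ p
  · exact conclusion_of_extreme hf hext G t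
  by_cases h1 : p = 1
  · subst h1
    exact conclusion_of_codim_one hf hB hHodge
  · exact conclusion_of_codim_add_one_eq hf (by omega) hB hHodge

/-- **Relative dimension `≤ 3` at an abelian-presented fibre**: every codimension is a corner
(`p ≤ 1` or `p + 1 ≥ 3 ≥ m`), so the conclusion holds for every `p` — the family form of the Hodge
conjecture for abelian varieties of dimension `≤ 3` (`Unconditional.hodgeConjectureFor_of_dim_le_three_holds`).
[cite: VoisinHodgeII2003, §10.2.3 proof of Prop. 10.26] -/
theorem conclusion_of_dim_le_three (hf : IsSmoothProjectiveFamily f m) (hm : m ≤ 3) {p : ℕ}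
    {G : HodgeTheory.complexBetti 𝒳 (2 * p)} {B : AbelianVariety ℂ} {eB : B.X ⟶ 𝒳}
    {t : ComplexPoints S} (hB : FibreIncl[f, B, eB, t]) (hHodge : HodgeAlong[S, 𝒳, f, G, p]) :
    HodgeTheory.complexBetti.map (fiberι f t) (2 * p) G ∈
      HodgeTheory.algebraicClasses (fiberOver f t) p :=
  conclusion_of_not_deepMiddle hf (by omega) hB hHodge

/-- **The anchor point always satisfies the conclusion** (junk audit: only the neighbouring fibres
carry content): `G|_{𝒳_{s₀}}` is algebraic as soon as `e₀^* G` is algebraic on the presenting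
abelian variety `A₀ ≅ 𝒳_{s₀}` (iso-invariance). So `U = {s₀}` closes the stub exactly when `s₀` is
isolated in `S(ℂ)` — never for `dim S ≥ 1` (`Stubs.interior_setOf_pt_mem_eq_empty`), always for
`S = Spec ℂ`. [folklore] -/
theorem localVHCAtCM_anchor (hf : IsSmoothProjectiveFamily f m) {p : ℕ}
    {G : HodgeTheory.complexBetti 𝒳 (2 * p)} {A₀ : AbelianVariety ℂ} {e₀ : A₀.X ⟶ 𝒳}
    {s₀ : ComplexPoints S} (hA₀ : FibreIncl[f, A₀, e₀, s₀])
    (halg : HodgeTheory.complexBetti.map e₀ (2 * p) G ∈ HodgeTheory.algebraicClasses A₀.X p) :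
    HodgeTheory.complexBetti.map (fiberι f s₀) (2 * p) G ∈
      HodgeTheory.algebraicClasses (fiberOver f s₀) p :=
  (SubtorusGalleryBlochSeeds.Stubs.map_mem_algebraicClasses_iff_of_fibreIncl hf hA₀ p G).1 halg

/-- **The instance of the stub at a family in the extreme codimensions holds with `U = S(ℂ)`**
(`p = 0` or `m ≤ p`; no use of the anchor, of `HodgeAlong`, of `QProj`, smoothness or
irreducibility of the base). [cite: VoisinHodgeII2003, §10.2.3 proof of Prop. 10.26] -/
theorem localVHCAtCM_instance_of_extreme (hf : IsSmoothProjectiveFamily f m) {p : ℕ}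
    (hp : p = 0 ∨ m ≤ p) (G : HodgeTheory.complexBetti 𝒳 (2 * p)) (s₀ : ComplexPoints S) :
    ∃ U : Set (ComplexPoints S), IsOpen U ∧ s₀ ∈ U ∧ ∀ t ∈ U,
      HodgeTheory.complexBetti.map (fiberι f t) (2 * p) G ∈
        HodgeTheory.algebraicClasses (fiberOver f t) p :=
  ⟨Set.univ, isOpen_univ, Set.mem_univ _, fun t _ => conclusion_of_extreme hf hp G t⟩

/-- **The instance of the stub at a family outside the deep middle holds with `U = S(ℂ)`, granted
that every complex fibre of THIS family is presented by an abelian variety** (hypothesis `hAVf`, the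
instance of `AbelianFibres[]`; GIT Thm. 6.14 in print). [cite: MumfordFogartyKirwan1994, Ch. 6 §1 Thm. 6.14]
[cite: VoisinHodgeI2002, Thm. 6.25 and Thm. 11.30] -/
theorem localVHCAtCM_instance_of_not_deepMiddle (hf : IsSmoothProjectiveFamily f m) {p : ℕ}
    (hp : p ≤ 1 ∨ m ≤ p + 1) (G : HodgeTheory.complexBetti 𝒳 (2 * p)) (s₀ : ComplexPoints S)
    (hAVf : ∀ t : ComplexPoints S, ∃ (B : AbelianVariety ℂ) (eB : B.X ⟶ 𝒳), FibreIncl[f, B, eB, t])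
    (hHodge : HodgeAlong[S, 𝒳, f, G, p]) :
    ∃ U : Set (ComplexPoints S), IsOpen U ∧ s₀ ∈ U ∧ ∀ t ∈ U,
      HodgeTheory.complexBetti.map (fiberι f t) (2 * p) G ∈
        HodgeTheory.algebraicClasses (fiberOver f t) p := by
  refine ⟨Set.univ, isOpen_univ, Set.mem_univ _, fun t _ => ?_⟩
  obtain ⟨B, eB, hB⟩ := hAVf t
  exact conclusion_of_not_deepMiddle hf hp hB hHodge

end Corners

/-! ### The deep-middle localisation of the stub -/

/-- **`LocalVHCAtCM[]` is EQUIVALENT to its deep-middle part `LocalVHCAtCMDeepMiddle[]`** (relative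
dimension `m ≥ 4`, codimensions `2 ≤ p ≤ m - 2`), granted `AbelianFibres[]` (GIT Thm. 6.14, a
HYPOTHESIS): the forward direction drops the three range arrows; conversely, outside the deep middle
the instance holds with `U = S(ℂ)` (`localVHCAtCM_instance_of_not_deepMiddle`: extreme codimensions,
Lefschetz `(1,1)`, hard Lefschetz — all THEOREMS of the tree), and inside it `4 ≤ m` is forced. This is
the family form of `Unconditional.hodgeAbelianVarieties_iff_deepMiddle_holds` with the weaker upper
cut-off `p ≤ m - 2` (the hard-Lefschetz reduction `p ↦ m - p` of a GLOBAL class is not available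
fibrewise without the theorem of the fixed part and Lefschetz standard for abelian varieties).
[cite: MumfordFogartyKirwan1994, Ch. 6 §1 Thm. 6.14] [cite: VoisinHodgeI2002, Thm. 6.25 and Thm. 11.30]
[cite: KerrPearlstein2011, §3.1] -/
theorem localVHCAtCM_iff_deepMiddle : AbelianFibres[] → (LocalVHCAtCM[] ↔ LocalVHCAtCMDeepMiddle[]) := by
  intro hAV
  refine ⟨fun h S 𝒳 f m p G s₀ A₀ e₀ _ _ _ => h S 𝒳 f m p G s₀ A₀ e₀, fun h => ?_⟩
  intro S 𝒳 f m p G s₀ A₀ e₀ h𝒳 hS hSsm hirr hf hA₀ hCM halg hHodge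
  by_cases hdeep : 2 ≤ p ∧ p + 2 ≤ m
  · exact h S 𝒳 f m p G s₀ A₀ e₀ (by omega) hdeep.1 hdeep.2 h𝒳 hS hSsm hirr hf hA₀ hCM halg hHodge
  · exact localVHCAtCM_instance_of_not_deepMiddle hf (by omega) G s₀
      (hAV S 𝒳 f m s₀ A₀ e₀ h𝒳 hS hSsm hirr hf hA₀) hHodge

/-- **The stub from its deep-middle part** (arrow form of `localVHCAtCM_iff_deepMiddle`): granted
`AbelianFibres[]` (GIT Thm. 6.14, HYPOTHESIS), local variational Hodge at a CM fibre for relative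
dimension `m ≥ 4` in codimensions `2 ≤ p ≤ m - 2` implies it in general — the corners `p ≤ 1`,
`p + 1 ≥ m` (hence all of `m ≤ 3`) being theorems. [cite: MumfordFogartyKirwan1994, Ch. 6 §1 Thm. 6.14]
[cite: VoisinHodgeI2002, Thm. 6.25 and Thm. 11.30] -/
theorem localVHCAtCM_of_deepMiddle : LocalVHCAtCMDeepMiddle[] → AbelianFibres[] → LocalVHCAtCM[] :=
  fun h hAV => (localVHCAtCM_iff_deepMiddle hAV).2 h

/-- **Upper bound for the deep-middle germ**: it follows from the DEEP-MIDDLE part of the Hodge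
conjecture for abelian varieties of dimension `≥ 4` (rational `(p,p)`-classes with `2 ≤ p ≤ dim A - 2`
are algebraic — a HYPOTHESIS here, the open core of the crux by
`Unconditional.hodgeAbelianVarieties_iff_four_le_dim_holds`), granted `AbelianFibres[]`: at each `t`
present `𝒳_t` by `B` (`dim B = m ≥ 4`), apply the hypothesis to `e_B^* G` and move algebraicity back
to THE fibre. So the localisation claims no more than the crux. [cite: CharlesSchnell2014Notes, Cor. 11.3.6]
[cite: MumfordFogartyKirwan1994, Ch. 6 §1 Thm. 6.14] -/
theorem localVHCAtCMDeepMiddle_of_hodge_deepMiddle : (∀ (A : AbelianVariety ℂ) (p : ℕ), 4 ≤ A.dim → 2 ≤ p → p + 2 ≤ A.dim → ∀ c : HodgeTheory.complexBetti A.X (2 * p), HodgeTheory.IsRationalClass c → HodgeTheory.IsOfHodgeType A.dim A.X (2 * p) p p c → c ∈ HodgeTheory.algebraicClasses A.X p) → AbelianFibres[] → LocalVHCAtCMDeepMiddle[] := by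
  intro hHC hAV S 𝒳 f m p G s₀ A₀ e₀ hm hp hpm h𝒳 hS hSsm hirr hf hA₀ _ _ hHodge
  refine ⟨Set.univ, isOpen_univ, Set.mem_univ _, fun t _ => ?_⟩
  obtain ⟨B, eB, hB⟩ := hAV S 𝒳 f m s₀ A₀ e₀ h𝒳 hS hSsm hirr hf hA₀ t
  have hdim : B.dim = m := SubtorusGalleryBlochSeeds.Stubs.dim_eq_of_fibreIncl hf hB
  exact conclusion_of_fibreIncl hf hB hHodge fun c hc hpp =>
    hHC B p (by omega) hp (by omega) c hc hpp

/-- **The stub from the deep-middle part of the Hodge conjecture for abelian varieties of dimension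
`≥ 4`** (codimensions `2 ≤ p ≤ dim A - 2`; HYPOTHESIS), granted `AbelianFibres[]` — the sharpening of
the skeleton's `localVHCAtCM_of_hodgeAbelianVarieties` by the corners: what child 3 asks of the Hodge
conjecture is confined to abelian varieties of dimension `≥ 4` in codimensions `2 ≤ p ≤ dim - 2`.
[cite: CharlesSchnell2014Notes, Cor. 11.3.6] [cite: MumfordFogartyKirwan1994, Ch. 6 §1 Thm. 6.14] -/
theorem localVHCAtCM_of_hodge_deepMiddle : (∀ (A : AbelianVariety ℂ) (p : ℕ), 4 ≤ A.dim → 2 ≤ p → p + 2 ≤ A.dim → ∀ c : HodgeTheory.complexBetti A.X (2 * p), HodgeTheory.IsRationalClass c → HodgeTheory.IsOfHodgeType A.dim A.X (2 * p) p p c → c ∈ HodgeTheory.algebraicClasses A.X p) → AbelianFibres[] → LocalVHCAtCM[] :=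
  fun hHC hAV => localVHCAtCM_of_deepMiddle (localVHCAtCMDeepMiddle_of_hodge_deepMiddle hHC hAV) hAV

/-! ### Junk audit: the hypotheses of the stub are jointly satisfiable -/

/-- **Non-vacuity of `LocalVHCAtCM[]`**: its nine hypotheses are jointly satisfiable — the constant
family `A ⟶ Spec ℂ` of the zero abelian variety `A` (`Negative.exists_abelianVariety_dim_eq_zero`;
`IsCM[A]` is vacuous in dimension `0`, the eigenvalue family being indexed by `Fin 0`), `p = 0`,
`G = 0` (rational and of type `(0,0)` on every presented fibre, `Stubs.hodgeAlong_toUnit`; algebraic as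
`N⁰ H⁰ = H⁰`); `A.X` and `Spec ℂ` are projective, `Spec ℂ` is smooth and irreducible (`Stubs.unit_base`).
So the stub is not vacuously true; its degenerate end is an honest instance (conclusion by
`localVHCAtCM_instance_of_extreme`). [folklore] -/
theorem localVHCAtCM_hypotheses_nonempty : ∃ (S 𝒳 : SchemeOver ℂ) (f : 𝒳 ⟶ S) (m p : ℕ) (G : HodgeTheory.complexBetti 𝒳 (2 * p)) (s₀ : ComplexPoints S) (A₀ : AbelianVariety ℂ) (e₀ : A₀.X ⟶ 𝒳), QProj[𝒳] ∧ QProj[S] ∧ AlgebraicGeometry.Smooth S.hom ∧ IrreducibleSpace S.left ∧ IsSmoothProjectiveFamily f m ∧ FibreIncl[f, A₀, e₀, s₀] ∧ IsCM[A₀] ∧ HodgeTheory.complexBetti.map e₀ (2 * p) G ∈ HodgeTheory.algebraicClasses A₀.X p ∧ HodgeAlong[S, 𝒳, f, G, p] := by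
  obtain ⟨A, hA⟩ :=
    Summit.HodgeConjecture.HodgeConjecture.Theorems.HodgeAbelianVarieties.Negative.exists_abelianVariety_dim_eq_zero
  have hX : IsSmoothProjective A.dim A.X := AbelianVariety.isSmoothProjective_holds
  obtain ⟨hS, hSsm, hirr⟩ := SubtorusGalleryBlochSeeds.Stubs.unit_base
  refine ⟨MonoidalCategoryStruct.tensorUnit (SchemeOver ℂ), A.X, CartesianMonoidalCategory.toUnit A.X,
    A.dim, 0, 0, CartesianMonoidalCategory.toUnit _, A, 𝟙 A.X,
    HodgeTheory.IsQuasiProjectiveOver.of_isProjectiveOver hX.isProjectiveOver, hS, hSsm, hirr,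
    SubtorusGalleryBlochSeeds.Stubs.isSmoothProjectiveFamily_toUnit A,
    SubtorusGalleryBlochSeeds.Stubs.fibreIncl_toUnit A _,
    ⟨0, fun _ => 0, fun i => absurd i.2 (by omega), fun i => absurd i.2 (by omega)⟩,
    HodgeTheory.hodgeConjectureFor_codim_zero _, ?_⟩
  exact SubtorusGalleryBlochSeeds.Stubs.hodgeAlong_toUnit HodgeTheory.IsRationalClass.zero
    (HodgeTheory.isOfHodgeType_zero_of_isSmoothProjective HodgeTheory.nonempty_hodgeModel_holds hX
      (2 * 0) 0 0)

end Summit.HodgeConjecture.HodgeConjecture.Cruxes.HodgeAbelianVarieties.CMPivot.Stubs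

end
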